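import Mathlib
import HarnessLib
import Literature.MathematicalPhysics.QuantumLattice.HubbardFreeTorusGroundEnergy
import Literature.MathematicalPhysics.QuantumLattice.TorusBandEdgeCounting
import Summits.HubbardSuperconductivity.HubbardSuperconductivity.Theorems.WeakCouplingBCSWcbcsBcsConstructionEnergyDensityLimit

/-!
# Route `ThermalWedge`, item `stmt-HubbardSuperconductivity-1702` (`TwPureThermalBound`):
# the grand-canonical ground-state energy density `g(μ)` of the 2D Hubbard torus and the
# localisation of the canonical chemical potential

Support file (`--supports stmt-HubbardSuperconductivity-1702`; no definition; the route file is NOT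
imported). Notation: `G_L(μ) = E₀(hubbardTorusWith 2 L 1 U μ)` and `g(μ) = lim_L G_L(μ)/L²`.

* `ptbm_gcLimit_exists`: the limit `g` exists for every `U, μ` (this is
  `stub_torusGcEnergyDensityLimit` of the route `WeakCouplingBCS`, re-indexed from `L + 1` to `L`);
* for ANY pointwise limit `g`: `0 ≤ g(μ) − g(ν) ≤ 2(ν − μ)` for `μ ≤ ν` (`ptbm_gcLimit_sub_mem_Icc`,
  from the finite-volume `2L²`-Lipschitz bound), hence `g` is continuous (`ptbm_gcLimit_continuous`);
  `g` is concave (`ptbm_gcLimit_concaveOn`); the interaction sandwich `g⁰ ≤ g ≤ g⁰ + U`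
  (`ptbm_gcLimit_free_le`, `ptbm_gcLimit_le_free_add`) for the free limit `g⁰` (`U = 0`);
* the two FREE-GAS density inequalities in the limit, from the finite-volume secant inequalities of
  `HubbardFreeTorusGroundEnergy.lean` and the level counts of `TorusBandEdgeCounting.lean`:
  `g⁰(μ_u + h) ≤ g⁰(μ_u) − (19/20) h` at `μ_u = −cos²(49π/100)` (density `≥ 19/20` just below the band
  centre, `ptbm_free_upperEdge`) and `g⁰(−15/4 − h) ≤ g⁰(−15/4) + h/2` (density `≤ 1/2` just above the
  band bottom, `ptbm_free_lowerEdge`), `h ≥ 0`;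
* **localisation** (`ptbm_exists_optimal_mu`): for `ρ₀ ∈ [3/5, 9/10]` and `0 ≤ U ≤ min(cos²(49π/100)/80, 1/160)`
  there is `μ₀ ∈ [−31/8, −cos²(49π/100)/2] ⊂ (−4, 0)` minimising `μ ↦ −g(μ) − ρ₀μ` on a neighbourhood,
  i.e. with `g(μ₀ − τ) − g(μ₀) ≤ ρ₀τ ≤ g(μ₀) − g(μ₀ + τ)` for `0 < τ ≤ 1` — the density `ρ₀` lies in
  the supergradient interval of the concave `g` at `μ₀` (argmin on a compact window; the free-gas
  inequalities push the argmin off the window's ends by three-point concavity). No differentiability of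
  `g` is used or claimed.

Ruelle, *Statistical Mechanics: Rigorous Results* (1969), §3.4; Griffiths, J. Math. Phys. 5 (1964)
1215. Everything is [folklore] real analysis over the cited tree facts.
-/

set_option linter.dupNamespace false

noncomputable section

namespace Summit.HubbardSuperconductivity.HubbardSuperconductivity.Theorems

open Literature.MathematicalPhysics.QuantumLattice Literature.Probability.LatticeModels Matrix Finset Filter
open scoped Topology

/-! ### Existence of the limit -/

/-- **The grand-canonical ground-state energy density of the 2D Hubbard torus has a thermodynamic
limit**: for every `U` there is `g : ℝ → ℝ` with `E₀(hubbardTorusWith 2 L 1 U μ)/L² → g(μ)` for all `μ`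
(`stub_torusGcEnergyDensityLimit`, re-indexed). [folklore] -/
theorem ptbm_gcLimit_exists (U : ℝ) :
    ∃ g : ℝ → ℝ, ∀ μ : ℝ, Tendsto (fun L : ℕ => (hubbardTorusWith 2 L 1 U μ).groundEnergy / (L : ℝ) ^ 2)
      atTop (𝓝 (g μ)) := by
  choose g hg using fun μ => stub_torusGcEnergyDensityLimit U μ
  refine ⟨g, fun μ => ?_⟩
  exact (tendsto_add_atTop_iff_nat (f := fun L : ℕ =>
    (hubbardTorusWith 2 L 1 U μ).groundEnergy / (L : ℝ) ^ 2) 1).mp (hg μ)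

/-! ### Properties of any pointwise limit -/

section Limit

variable {U : ℝ} {g : ℝ → ℝ}
  (hg : ∀ μ : ℝ, Tendsto (fun L : ℕ => (hubbardTorusWith 2 L 1 U μ).groundEnergy / (L : ℝ) ^ 2)
    atTop (𝓝 (g μ)))

include hg

/-- **Monotonicity and Lipschitz bound in the limit**: `0 ≤ g(μ) − g(ν) ≤ 2(ν − μ)` for `μ ≤ ν`.
[folklore] -/
theorem ptbm_gcLimit_sub_mem_Icc {μ ν : ℝ} (h : μ ≤ ν) : g μ - g ν ∈ Set.Icc (0 : ℝ) (2 * (ν - μ)) := by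
  have hlim := (hg μ).sub (hg ν)
  have hev : ∀ᶠ L : ℕ in atTop,
      (hubbardTorusWith 2 L 1 U μ).groundEnergy / (L : ℝ) ^ 2 -
          (hubbardTorusWith 2 L 1 U ν).groundEnergy / (L : ℝ) ^ 2 ∈ Set.Icc (0 : ℝ) (2 * (ν - μ)) := by
    refine eventually_atTop.2 ⟨1, fun L hL => ?_⟩
    have hL : (0 : ℝ) < (L : ℝ) ^ 2 := by positivity
    have hb := groundEnergy_torus_sub_mem_Icc_of_le L 1 U h
    rw [← sub_div]
    constructor
    · exact div_nonneg hb.1 hL.le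
    · rw [div_le_iff₀ hL]
      nlinarith [hb.2]
  exact ⟨ge_of_tendsto hlim (hev.mono fun L hL => hL.1), le_of_tendsto hlim (hev.mono fun L hL => hL.2)⟩

/-- The limit is `2`-Lipschitz, hence continuous. [folklore] -/
theorem ptbm_gcLimit_continuous : Continuous g := by
  refine (LipschitzWith.of_dist_le_mul (K := 2) fun x y => ?_).continuous
  rw [Real.dist_eq, Real.dist_eq]
  rcases le_total x y with h | h
  · have hb := ptbm_gcLimit_sub_mem_Icc hg h
    rw [abs_of_nonneg hb.1, abs_of_nonpos (sub_nonpos.2 h)]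
    push_cast
    linarith [hb.2]
  · have hb := ptbm_gcLimit_sub_mem_Icc hg h
    rw [abs_sub_comm, abs_of_nonneg hb.1, abs_of_nonneg (sub_nonneg.2 h)]
    push_cast
    linarith [hb.2]

/-- **The limit is concave** (pointwise limit of the concave `μ ↦ G_L(μ)/L²`). [folklore] -/
theorem ptbm_gcLimit_concaveOn : ConcaveOn ℝ Set.univ g := by
  refine ⟨convex_univ, fun x _ y _ a b ha hb hab => ?_⟩
  have hlim := ((hg x).const_mul a).add ((hg y).const_mul b)
  have hlim2 := hg (a • x + b • y)
  refine le_of_tendsto_of_tendsto hlim hlim2 (eventually_atTop.2 ⟨1, fun L hL => ?_⟩)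
  have hL : (0 : ℝ) < (L : ℝ) ^ 2 := by positivity
  have hc := (concaveOn_groundEnergy_hubbardTorusWith L 1 U).2 (Set.mem_univ x) (Set.mem_univ y) ha hb hab
  simp only [smul_eq_mul] at hc ⊢
  rw [← mul_div_assoc, ← mul_div_assoc, ← add_div]
  exact div_le_div_of_nonneg_right hc hL.le

variable {g₀ : ℝ → ℝ}
  (hg₀ : ∀ μ : ℝ, Tendsto (fun L : ℕ => (hubbardTorusWith 2 L 1 0 μ).groundEnergy / (L : ℝ) ^ 2)
    atTop (𝓝 (g₀ μ)))

include hg₀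

/-- **Interaction sandwich in the limit, lower**: `g⁰(μ) ≤ g(μ)` for `U ≥ 0`. [folklore] -/
theorem ptbm_gcLimit_free_le (hU : 0 ≤ U) (μ : ℝ) : g₀ μ ≤ g μ := by
  refine le_of_tendsto_of_tendsto (hg₀ μ) (hg μ) (eventually_atTop.2 ⟨1, fun L hL => ?_⟩)
  have hL : (0 : ℝ) < (L : ℝ) ^ 2 := by positivity
  have hb := (groundEnergy_torus_sub_free_mem_Icc L 1 μ hU).1
  exact div_le_div_of_nonneg_right (by linarith) hL.le

/-- **Interaction sandwich in the limit, upper**: `g(μ) ≤ g⁰(μ) + U` for `U ≥ 0`. [folklore] -/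
theorem ptbm_gcLimit_le_free_add (hU : 0 ≤ U) (μ : ℝ) : g μ ≤ g₀ μ + U := by
  have hlim : Tendsto (fun L : ℕ => (hubbardTorusWith 2 L 1 0 μ).groundEnergy / (L : ℝ) ^ 2 + U) atTop
      (𝓝 (g₀ μ + U)) := (hg₀ μ).add_const U
  refine le_of_tendsto_of_tendsto (hg μ) hlim (eventually_atTop.2 ⟨1, fun L hL => ?_⟩)
  have hL : (0 : ℝ) < (L : ℝ) ^ 2 := by positivity
  have hb := (groundEnergy_torus_sub_free_mem_Icc L 1 μ hU).2
  have : (hubbardTorusWith 2 L 1 U μ).groundEnergy / (L : ℝ) ^ 2 ≤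
      ((hubbardTorusWith 2 L 1 0 μ).groundEnergy + U * (L : ℝ) ^ 2) / (L : ℝ) ^ 2 :=
    div_le_div_of_nonneg_right (by linarith) hL.le
  rw [add_div, mul_div_cancel_right₀ _ hL.ne'] at this
  exact this

end Limit

/-! ### The two free-gas density inequalities in the limit -/

section Free

variable {g₀ : ℝ → ℝ}
  (hg₀ : ∀ μ : ℝ, Tendsto (fun L : ℕ => (hubbardTorusWith 2 L 1 0 μ).groundEnergy / (L : ℝ) ^ 2)
    atTop (𝓝 (g₀ μ)))

include hg₀

/-- **Free density `≥ 19/20` just below the band centre, in the limit**: with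
`μ_u = −cos²(49π/100)`, `g⁰(μ_u + h) ≤ g⁰(μ_u) − (19/20) h` for `h ≥ 0` (finite-volume secant
`groundEnergy_free_le_sub_card` and the diamond count `card_filter_torusBand_lt_upperEdge`). [folklore] -/
theorem ptbm_free_upperEdge {h : ℝ} (hh : 0 ≤ h) :
    g₀ (-Real.cos (49 * Real.pi / 100) ^ 2 + h) ≤ g₀ (-Real.cos (49 * Real.pi / 100) ^ 2) - 19 / 20 * h := by
  set μu : ℝ := -Real.cos (49 * Real.pi / 100) ^ 2 with hμu
  have hlim : Tendsto (fun L : ℕ => (hubbardTorusWith 2 L 1 0 μu).groundEnergy / (L : ℝ) ^ 2 - 19 / 20 * h)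
      atTop (𝓝 (g₀ μu - 19 / 20 * h)) := (hg₀ μu).sub_const _
  refine le_of_tendsto_of_tendsto (hg₀ (μu + h)) hlim (eventually_atTop.2 ⟨400, fun L hL => ?_⟩)
  haveI : NeZero L := ⟨by omega⟩
  have hL2 : (0 : ℝ) < (L : ℝ) ^ 2 := by positivity
  have h1 := groundEnergy_free_le_sub_card (L := L) (by omega) (μ := μu + h) (μ' := μu) (by linarith)
  have h2 := card_filter_torusBand_lt_upperEdge (L := L) hL
  rw [add_sub_cancel_left] at h1
  have h3 : 2 * h * (19 / 40 * (L : ℝ) ^ 2) ≤ 2 * h *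
      (((Finset.univ.filter fun k : TorusSite 2 L => torusBand L k < -Real.cos (49 * Real.pi / 100) ^ 2).card : ℕ) : ℝ) :=
    mul_le_mul_of_nonneg_left h2 (by positivity)
  have h4 : (hubbardTorusWith 2 L 1 0 (μu + h)).groundEnergy ≤
      (hubbardTorusWith 2 L 1 0 μu).groundEnergy - 19 / 20 * h * (L : ℝ) ^ 2 := by
    rw [hμu] at h1 ⊢; linarith
  show (hubbardTorusWith 2 L 1 0 (μu + h)).groundEnergy / (L : ℝ) ^ 2 ≤
    (hubbardTorusWith 2 L 1 0 μu).groundEnergy / (L : ℝ) ^ 2 - 19 / 20 * h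
  rw [div_le_iff₀ hL2, sub_mul, div_mul_cancel₀ _ hL2.ne']
  exact h4

/-- **Free density `≤ 1/2` just above the band bottom, in the limit**:
`g⁰(−15/4 − h) ≤ g⁰(−15/4) + h/2` for `h ≥ 0` (finite-volume secant `groundEnergy_free_le_add_card` and
the small-square count `card_filter_torusBand_lt_lowerEdge`). [folklore] -/
theorem ptbm_free_lowerEdge {h : ℝ} (hh : 0 ≤ h) :
    g₀ (-15 / 4 - h) ≤ g₀ (-15 / 4) + h / 2 := by
  have hlim : Tendsto (fun L : ℕ => (hubbardTorusWith 2 L 1 0 (-15 / 4)).groundEnergy / (L : ℝ) ^ 2 + h / 2)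
      atTop (𝓝 (g₀ (-15 / 4) + h / 2)) := (hg₀ (-15 / 4)).add_const _
  refine le_of_tendsto_of_tendsto (hg₀ (-15 / 4 - h)) hlim (eventually_atTop.2 ⟨4, fun L hL => ?_⟩)
  haveI : NeZero L := ⟨by omega⟩
  have hL2 : (0 : ℝ) < (L : ℝ) ^ 2 := by positivity
  have h1 := groundEnergy_free_le_add_card (L := L) (by omega) (μ := -15 / 4) (μ' := -15 / 4 - h) (by linarith)
  have h2 := card_filter_torusBand_lt_lowerEdge (L := L) hL
  rw [sub_sub_cancel] at h1
  have h3 : 2 * h * (((Finset.univ.filter fun k : TorusSite 2 L => torusBand L k < -15 / 4).card : ℕ) : ℝ) ≤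
      2 * h * ((L : ℝ) ^ 2 / 4) := mul_le_mul_of_nonneg_left h2 (by positivity)
  have h4 : (hubbardTorusWith 2 L 1 0 (-15 / 4 - h)).groundEnergy ≤
      (hubbardTorusWith 2 L 1 0 (-15 / 4)).groundEnergy + h / 2 * (L : ℝ) ^ 2 := by linarith
  show (hubbardTorusWith 2 L 1 0 (-15 / 4 - h)).groundEnergy / (L : ℝ) ^ 2 ≤
    (hubbardTorusWith 2 L 1 0 (-15 / 4)).groundEnergy / (L : ℝ) ^ 2 + h / 2
  rw [div_le_iff₀ hL2, add_mul, div_mul_cancel₀ _ hL2.ne']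
  exact h4

end Free

/-! ### Localisation of the canonical chemical potential -/

/-- `0 < cos²(49π/100)`. [folklore] -/
theorem ptbm_cos_sq_pos : 0 < Real.cos (49 * Real.pi / 100) ^ 2 := by
  have := upperEdge_neg
  nlinarith [sq_nonneg (Real.cos (49 * Real.pi / 100))]

/-- `cos²(49π/100) ≤ 1`. [folklore] -/
theorem ptbm_cos_sq_le_one : Real.cos (49 * Real.pi / 100) ^ 2 ≤ 1 := by
  rw [sq_le_one_iff_abs_le_one]
  exact Real.abs_cos_le_one _

/-- **Localisation of the canonical chemical potential.** Let `g` be the limiting grand-canonical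
energy density at coupling `0 ≤ U ≤ min(cos²(49π/100)/80, 1/160)` and `g⁰` the free one. For every
density `ρ₀ ∈ [3/5, 9/10]` there is `μ₀ ∈ [−31/8, −cos²(49π/100)/2]` with the one-sided secant
conditions `g(μ₀ − τ) − g(μ₀) ≤ ρ₀τ ≤ g(μ₀) − g(μ₀ + τ)` for all `0 < τ ≤ 1` (`μ₀` minimises
`−g − ρ₀·` on `[−39/8, 1 − cos²(49π/100)/2]`; the free-gas density inequalities, the sandwich
`g⁰ ≤ g ≤ g⁰ + U` and three-point concavity exclude the end zones). [folklore] -/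
theorem ptbm_exists_optimal_mu {U : ℝ} (hU : 0 ≤ U)
    (hU1 : U ≤ min (Real.cos (49 * Real.pi / 100) ^ 2 / 80) (1 / 160))
    {g g₀ : ℝ → ℝ}
    (hg : ∀ μ : ℝ, Tendsto (fun L : ℕ => (hubbardTorusWith 2 L 1 U μ).groundEnergy / (L : ℝ) ^ 2)
      atTop (𝓝 (g μ)))
    (hg₀ : ∀ μ : ℝ, Tendsto (fun L : ℕ => (hubbardTorusWith 2 L 1 0 μ).groundEnergy / (L : ℝ) ^ 2)
      atTop (𝓝 (g₀ μ)))
    {ρ₀ : ℝ} (hρ₁ : 3 / 5 ≤ ρ₀) (hρ₂ : ρ₀ ≤ 9 / 10) :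
    ∃ μ₀ ∈ Set.Icc (-31 / 8 : ℝ) (-Real.cos (49 * Real.pi / 100) ^ 2 / 2),
      (∀ τ : ℝ, 0 < τ → τ ≤ 1 → g (μ₀ - τ) - g μ₀ ≤ ρ₀ * τ) ∧
        (∀ τ : ℝ, 0 < τ → τ ≤ 1 → ρ₀ * τ ≤ g μ₀ - g (μ₀ + τ)) := by
  obtain ⟨c, hc⟩ : ∃ c : ℝ, c = Real.cos (49 * Real.pi / 100) ^ 2 := ⟨_, rfl⟩
  have hc0 : 0 < c := hc ▸ ptbm_cos_sq_pos
  have hc1 : c ≤ 1 := hc ▸ ptbm_cos_sq_le_one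
  rw [← hc] at hU1 ⊢
  have hUc : U ≤ c / 80 := hU1.trans (min_le_left _ _)
  have hU160 : U ≤ 1 / 160 := hU1.trans (min_le_right _ _)
  -- the objective `ψ = −g − ρ₀·` on the window `[−39/8, 1 − c/2]`
  obtain ⟨ψ, hψ⟩ : ∃ ψ : ℝ → ℝ, ψ = fun μ => -g μ - ρ₀ * μ := ⟨_, rfl⟩
  have hψc : Continuous ψ := by
    rw [hψ]; exact ((ptbm_gcLimit_continuous hg).neg).sub (continuous_const.mul continuous_id)
  obtain ⟨μ₀, hμ₀S, hmin⟩ := (isCompact_Icc (a := (-39 / 8 : ℝ)) (b := -c / 2 + 1)).exists_isMinOn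
    ⟨-31 / 8, by constructor <;> linarith⟩ hψc.continuousOn
  have hψle : ∀ x : ℝ, -39 / 8 ≤ x → x ≤ -c / 2 + 1 → -g μ₀ - ρ₀ * μ₀ ≤ -g x - ρ₀ * x := by
    intro x h1 h2
    have h : ψ μ₀ ≤ ψ x := hmin (show x ∈ Set.Icc (-39 / 8 : ℝ) (-c / 2 + 1) from ⟨h1, h2⟩)
    simpa only [hψ] using h
  have hconc := ptbm_gcLimit_concaveOn hg
  -- `−31/8 ≤ μ₀`: otherwise the slope of `g` on `[μ₀, −31/8]` is at least that on `[−31/8, −15/4]`,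
  -- which is `≥ −(1/2 + 8U) > −ρ₀`, contradicting minimality at `μ₀` against `−31/8`
  have hlow : -31 / 8 ≤ μ₀ := by
    by_contra hlt
    push Not at hlt
    have hf := ptbm_free_lowerEdge hg₀ (h := 1 / 8) (by norm_num)
    have ha := ptbm_gcLimit_le_free_add hg hg₀ hU (-15 / 4 - 1 / 8)
    have hb := ptbm_gcLimit_free_le hg hg₀ hU (-15 / 4)
    rw [show (-15 / 4 : ℝ) - 1 / 8 = -31 / 8 by norm_num] at hf ha
    have hslope1 : -(1 / 2 + 8 * U) * (1 / 8) ≤ g (-15 / 4) - g (-31 / 8) := by linarith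
    have h3 := hconc.slope_anti_adjacent (x := μ₀) (y := -31 / 8) (z := -15 / 4) (Set.mem_univ _)
      (Set.mem_univ _) hlt (by norm_num)
    rw [show (-15 / 4 : ℝ) - -31 / 8 = 1 / 8 by norm_num] at h3
    have hpos : 0 < -31 / 8 - μ₀ := sub_pos.2 hlt
    rw [div_le_div_iff₀ (by norm_num) hpos] at h3
    have hm := mul_le_mul_of_nonneg_right hslope1 hpos.le
    have h4 : -(1 / 2 + 8 * U) * (-31 / 8 - μ₀) ≤ g (-31 / 8) - g μ₀ := by linarith
    have h5 : 1 / 2 + 8 * U < ρ₀ := by linarith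
    have h5' := mul_lt_mul_of_pos_right h5 hpos
    have h7 := hψle (-31 / 8) (by norm_num) (by linarith)
    linarith
  -- `μ₀ ≤ −c/2`: otherwise the slope of `g` on `[−c/2, μ₀]` is at most that on `[−c, −c/2]`, which is
  -- `≤ −19/20 + 2U/c < −ρ₀`, contradicting minimality at `μ₀` against `−c/2`
  have hupp : μ₀ ≤ -c / 2 := by
    by_contra hlt
    push Not at hlt
    have hf := ptbm_free_upperEdge hg₀ (h := c / 2) (by positivity)
    have ha := ptbm_gcLimit_le_free_add hg hg₀ hU (-c + c / 2)
    have hb := ptbm_gcLimit_free_le hg hg₀ hU (-c)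
    rw [← hc] at hf
    rw [show -c + c / 2 = -c / 2 by ring] at hf ha
    have hslope1 : g (-c / 2) - g (-c) ≤ -(19 / 20) * (c / 2) + U := by linarith
    have h3 := hconc.slope_anti_adjacent (x := -c) (y := -c / 2) (z := μ₀) (Set.mem_univ _)
      (Set.mem_univ _) (by linarith) hlt
    rw [show -c / 2 - -c = c / 2 by ring] at h3
    have hpos : 0 < μ₀ - -c / 2 := sub_pos.2 hlt
    rw [div_le_div_iff₀ hpos (by positivity)] at h3
    have hm := mul_le_mul_of_nonneg_right hslope1 hpos.le
    -- `(g μ₀ − g(−c/2))·(c/2) ≤ (−(19/20)(c/2) + U)(μ₀ + c/2)` and `U ≤ c/80`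
    have hUc' : U * (μ₀ - -c / 2) ≤ c / 80 * (μ₀ - -c / 2) := mul_le_mul_of_nonneg_right hUc hpos.le
    have h4 : (g μ₀ - g (-c / 2)) * (c / 2) ≤ (-(37 / 40) * (μ₀ - -c / 2)) * (c / 2) := by linarith
    have h4' : g μ₀ - g (-c / 2) ≤ -(37 / 40) * (μ₀ - -c / 2) := le_of_mul_le_mul_right h4 (by positivity)
    have h5 : (37 / 40 : ℝ) > ρ₀ := by linarith
    have h5' := mul_lt_mul_of_pos_right h5 hpos
    have h7 := hψle (-c / 2) (by linarith) (by linarith)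
    linarith
  refine ⟨μ₀, ⟨hlow, by linarith⟩, fun τ hτ hτ1 => ?_, fun τ hτ hτ1 => ?_⟩
  · have h := hψle (μ₀ - τ) (by linarith) (by linarith)
    linarith
  · have h := hψle (μ₀ + τ) (by linarith) (by linarith)
    linarith

end Summit.HubbardSuperconductivity.HubbardSuperconductivity.Theorems

end
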